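import Literature.MathematicalPhysics.QuantumManyBody.PeriodicGroundStateFeynmanKacProofsWitness
import Literature.MathematicalPhysics.QuantumManyBody.PeriodicFeynmanKacTrialState
import Literature.MathematicalPhysics.QuantumManyBody.PeriodicHeatFlowSpectral
import HarnessLib

/-!
# Proof of `PeriodicGroundStateFeynmanKac`, III: the ground-state projection and the theorem

Topic `Literature/MathematicalPhysics/QuantumManyBody`; theorems only (no definition, no named
fact). This file discharges the named fact
`Literature.MathematicalPhysics.QuantumManyBody.BoseGas.PeriodicGroundStateFeynmanKac` of
`PeriodicHeatFlowSpectral.lean`: its last declaration is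
**`theorem PeriodicGroundStateFeynmanKac_holds : PeriodicGroundStateFeynmanKac`** — for `N ≥ 1`,
`L > 0` and a measurable pair potential `v` whose periodisation `v^per` is bounded, the torus
Hamiltonian `H_N^per = -∑Δᵢ + ∑_{i<j} v^per(xᵢ-xⱼ)` on `((ℝ/Lℤ)³)^N` has a cell-normalised,
nonnegative, continuous, strictly positive, periodic, Bose-symmetric ground state `Ψ₀` in
Feynman–Kac form (`IsPeriodicGroundStateFK v L Ψ₀`). It is the torus twin of
`GroundStateFeynmanKac_holds` (`GroundStateFeynmanKacProofs.lean`, Part IV), with no boundary step.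

The assembly follows the printed proofs (Chung–Zhao (1995) §3.2 and §8.3; Reed–Simon IV
Thm XIII.44; Glimm–Jaffe §3.3–3.4): Perron–Frobenius data `(e, μ₀ = ‖T_1‖)` of the compact
positivity-improving operator `T_1 = e^{-H_N^per}` on `L²([0,L)^{3N})` (`pfkL2_perronFrobenius`,
`PeriodicFeynmanKacPerronFrobenius.lean`); the witness `Ψ₀ = μ₀⁻¹ T_1 |e ∘ cellProj L|` with its
pointwise eigen-relation, continuity, strict positivity and Bose symmetry
(`PeriodicGroundStateFeynmanKacProofsEigen/Witness.lean`); here: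

* `setLIntegral_cellN_ofReal_sq_eq_one`, `setIntegral_cellN_sq_eq_one` — normalisation
  `∫_cell Ψ₀² = 1` (`Ψ₀ = e` a.e. on the cell, `‖e‖ = 1`);
* `tendsto_rpow_mul_pfkReal_comp_cellProj`, `tendsto_rpow_mul_pfkReal`,
  `tendsto_exp_mul_periodicFKSemigroup` — the **ground-state projection at every point**
  `e^{λT}(e^{-TH}G)(X) → ⟨Ψ₀, G⟩_cell Ψ₀(X)` (`λ = -log μ₀`) for `G ∈ L²(cell)` (classes, periodic
  real functions, resp. periodic `[0, ∞]`-valued functions): the `L²` statement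
  `tendsto_rpow_smul_semigroup` (`GroundStateFeynmanKacSpectral.lean`: spectral gap below the
  simple top eigenvalue; Glimm–Jaffe (3.4.2)) composed with the bounded evaluation
  `pfkEval v L 1 X` of `T_1 : L²(cell) → L^∞` (Chung–Zhao Thm 3.10);
* the identification `E₀ = periodicGroundStateEnergy v N L = λ`
  (`periodicGroundStateEnergy_toReal_eq_of_feynmanKac`, `PeriodicFeynmanKacTrialState.lean`, fed
  with the Rayleigh bound `setIntegral_cellN_mul_pfkReal_le_rpow` and the integrated
  eigen-relation), and the assembly of the structure `IsPeriodicGroundStateFK`.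

## References

* K. L. Chung, Z. Zhao, *From Brownian Motion to Schrödinger's Equation*, Grundlehren 312,
  Springer (1995), §3.2 (26), Thm 3.10, Props 3.11–3.15, Thm 3.27, Prop 3.29, §8.3 (29)–(30).
  [ChungZhao1995]
* M. Reed, B. Simon, *Methods of Modern Mathematical Physics IV: Analysis of Operators*,
  Academic Press (1978), §XIII.12 Thm XIII.44. [ReedSimonIV1978]
* J. Glimm, A. Jaffe, *Quantum Physics*, 2nd ed., Springer (1987), §3.3 Thms 3.3.2–3.3.3,
  §3.4 (3.4.2). [GlimmJaffeQP1987]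
-/

noncomputable section

namespace Literature.MathematicalPhysics.QuantumManyBody.BoseGas

open MeasureTheory ProbabilityTheory Filter Set
open scoped ENNReal NNReal Topology InnerProductSpace
open Literature.Probability.Process

variable {N : ℕ}

/-! ### Normalisation -/

section Norm

variable {L : ℝ} {e : Lp ℝ 2 (volume.restrict (cellN N L))} {Ψ₀ : Config N → ℝ}

/-- **`∫_cell Ψ₀² = 1` in `[0, ∞]`** for a nonnegative function `Ψ₀` agreeing a.e. on the cell with
a unit vector `e ∈ L²(cell)`. [folklore] -/
theorem setLIntegral_cellN_ofReal_sq_eq_one (he1 : ‖e‖ = 1)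
    (hΨe : Ψ₀ =ᵐ[volume.restrict (cellN N L)] (e : Config N → ℝ)) (hΨnn : ∀ X, 0 ≤ Ψ₀ X) :
    ∫⁻ X in cellN N L, ENNReal.ofReal (Ψ₀ X) ^ 2 = 1 := by
  have h2 : ∫⁻ X in cellN N L, ENNReal.ofReal (Ψ₀ X) ^ 2 =
      ∫⁻ X in cellN N L, ‖(e : Config N → ℝ) X‖ₑ ^ (2 : ℝ) := by
    refine lintegral_congr_ae ?_
    filter_upwards [hΨe] with X hX
    have h0 : 0 ≤ (e : Config N → ℝ) X := hX ▸ hΨnn X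
    rw [ENNReal.rpow_two, hX, Real.enorm_of_nonneg h0]
  have h3 := ofReal_norm_Lp_cellN e
  rw [he1, ENNReal.ofReal_one] at h3
  have h4 : (∫⁻ X in cellN N L, ‖(e : Config N → ℝ) X‖ₑ ^ (2 : ℝ)) =
      ((∫⁻ X in cellN N L, ‖(e : Config N → ℝ) X‖ₑ ^ (2 : ℝ)) ^ (1 / 2 : ℝ)) ^ (2 : ℝ) := by
    rw [← ENNReal.rpow_mul]; norm_num
  rw [h2, h4, ← h3, ENNReal.one_rpow]

/-- **`∫_cell Ψ₀² = 1` as a Bochner integral**, for a continuous periodic `Ψ₀ ≥ 0` with unit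
`[0, ∞]`-valued cell mass (`L > 0`). [folklore] -/
theorem setIntegral_cellN_sq_eq_one (hL : 0 < L) (hcont : Continuous Ψ₀)
    (hper : ∀ (X : Config N) (i : Fin N) (k : Fin 3),
      Ψ₀ (X + Pi.single i (EuclideanSpace.single k L)) = Ψ₀ X)
    (hΨnn : ∀ X, 0 ≤ Ψ₀ X) (h1 : ∫⁻ X in cellN N L, ENNReal.ofReal (Ψ₀ X) ^ 2 = 1) :
    ∫ X in cellN N L, Ψ₀ X ^ 2 = 1 := by
  obtain ⟨M, -, hM⟩ := exists_bound_of_continuous_periodic hL hcont hper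
  have hsq : Integrable (fun X => Ψ₀ X ^ 2) (volume.restrict (cellN N L)) :=
    (memLp_two_cellN_of_bound L hcont.measurable hM).integrable_sq
  rw [integral_eq_lintegral_of_nonneg_ae (Eventually.of_forall fun X => sq_nonneg _)
    hsq.aestronglyMeasurable]
  have : (fun X => ENNReal.ofReal (Ψ₀ X ^ 2)) = fun X => ENNReal.ofReal (Ψ₀ X) ^ 2 := by
    funext X; rw [ENNReal.ofReal_pow (hΨnn X)]
  rw [this, h1, ENNReal.toReal_one]

end Norm

/-! ### The ground-state projection at every point -/

/-- **The `L²(cell)` ground-state projection, evaluated at a point**: for a class `g ∈ L²(cell)`,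
`‖e^{-H}‖^{-t} (e^{-(1+t)H} g)(X) → ⟪e, g⟫ (e^{-H} e)(X)` as `t → ∞`, at EVERY `X` — the `L²`
statement `‖e^{-H}‖^{-t} e^{-tH} g → ⟪e, g⟫ e` (`tendsto_rpow_smul_semigroup`: spectral gap below the
simple top eigenvalue of the compact operator `e^{-H}`) composed with the bounded evaluation
`pfkEval v L 1 X` of `e^{-H} : L²(cell) → L^∞` (classes are read through their periodic
representatives `⇑g ∘ cellProj L`). Glimm–Jaffe (1987) (3.4.2); Chung–Zhao (1995) §8.3 (29)–(30).
[cite: GlimmJaffeQP1987, §3.4 (3.4.2)] -/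
theorem tendsto_rpow_mul_pfkReal_comp_cellProj {v : ℝ → ℝ≥0∞} (hv : Measurable v) {L : ℝ}
    (hL : 0 < L) {C : ℝ≥0} (hC : ∀ x, periodizedPotential v L x ≤ C)
    {e : Lp ℝ 2 (volume.restrict (cellN N L))} (he1 : ‖e‖ = 1)
    (hTe : pfkL2 v L 1 e = ‖pfkL2 (N := N) v L 1‖ • e)
    (hsimple : ∀ f, pfkL2 v L 1 f = ‖pfkL2 (N := N) v L 1‖ • f → ∃ c : ℝ, f = c • e)
    (g : Lp ℝ 2 (volume.restrict (cellN N L))) (X : Config N) :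
    Tendsto (fun t : ℝ => ‖pfkL2 (N := N) v L 1‖ ^ (-t) * pfkReal v L (1 + t) (⇑g ∘ cellProj L) X)
      atTop (𝓝 (⟪e, g⟫_ℝ * pfkReal v L 1 (⇑e ∘ cellProj L) X)) := by
  have hS1 : pfkL2 (N := N) v L 1 ≠ 0 := (pfkL2_perronFrobenius (N := N) hv hL hC one_pos).1
  have hadd : ∀ s t : ℝ, 0 < s → 0 < t →
      pfkL2 (N := N) v L (s + t) = (pfkL2 v L s).comp (pfkL2 v L t) :=
    fun s t hs ht => pfkL2_add_time hv hL hs ht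
  have hcontr : ∀ t : ℝ, 0 < t → ‖pfkL2 (N := N) v L t‖ ≤ 1 := fun t _ => norm_pfkL2_le_one v L t
  have hsym : ∀ t : ℝ, 0 < t → ∀ x y : Lp ℝ 2 (volume.restrict (cellN N L)),
      ⟪pfkL2 v L t x, y⟫_ℝ = ⟪x, pfkL2 v L t y⟫_ℝ := fun t ht x y => inner_pfkL2_comm hv hL ht x y
  have hpos : ∀ t : ℝ, 0 < t → ∀ x : Lp ℝ 2 (volume.restrict (cellN N L)),
      0 ≤ ⟪pfkL2 v L t x, x⟫_ℝ := fun t ht x => inner_pfkL2_self_nonneg hv hL ht x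
  have hc1 : IsCompactOperator (pfkL2 (N := N) v L 1) := isCompactOperator_pfkL2 hv hL hC one_pos
  have hL2 := tendsto_rpow_smul_semigroup (S := fun t => pfkL2 (N := N) v L t) hadd hcontr hsym hpos
    hc1 hS1 he1 hTe hsimple g
  have hΦ := ((pfkEval v L 1 X).continuous.tendsto _).comp hL2
  beta_reduce at hΦ
  have hgm : Measurable (⇑g ∘ cellProj L) :=
    (measurable_coeFn_Lp_cellN g).comp (measurable_cellProj L)
  have hgper := comp_cellProj_periodic hL.ne' (g : Config N → ℝ)
  have hg2 := setLIntegral_cellN_enorm_comp_cellProj_sq_ne_top hL g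
  have hlim : pfkEval v L 1 X (⟪e, g⟫_ℝ • e) = ⟪e, g⟫_ℝ * pfkReal v L 1 (⇑e ∘ cellProj L) X := by
    rw [ContinuousLinearMap.map_smul, smul_eq_mul, pfkEval_apply hv hL one_pos]
  rw [← hlim]
  refine hΦ.congr' ?_
  filter_upwards [eventually_gt_atTop 0] with t ht
  rw [Function.comp_apply, ContinuousLinearMap.map_smul, smul_eq_mul, pfkEval_apply hv hL one_pos,
    pfkReal_add_time hv hL one_pos ht hgm hgper hg2 X]
  exact congrArg (fun r => ‖pfkL2 (N := N) v L 1‖ ^ (-t) * r)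
    (pfkReal_congr_ae v L one_pos (pfkL2_coeFn_comp_cellProj hv hL ht g) X)

/-- **The real-valued ground-state projection at every point**: for periodic measurable real `g`
square integrable on the cell, `‖e^{-H}‖^{-T} (e^{-TH} g)(X) → ⟨Ψ₀, g⟩_cell Ψ₀(X)` as `T → ∞`, at EVERY
`X`, for any `Ψ₀` equal to `e` a.e. on the cell with `Ψ₀ = ‖e^{-H}‖⁻¹ e^{-H}(e ∘ cellProj L)`
pointwise (`tendsto_rpow_mul_pfkReal_comp_cellProj` for the class of `g`, shifted by one unit of
time: `‖e^{-H}‖^{-(1+t)} T_{1+t} g = ‖e^{-H}‖^{-1} · ‖e^{-H}‖^{-t} T_{1+t} g`). Glimm–Jaffe (1987)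
(3.4.2); Chung–Zhao (1995) §8.3 (29)–(30). [cite: GlimmJaffeQP1987, §3.4 (3.4.2)] -/
theorem tendsto_rpow_mul_pfkReal {v : ℝ → ℝ≥0∞} (hv : Measurable v) {L : ℝ}
    (hL : 0 < L) {C : ℝ≥0} (hC : ∀ x, periodizedPotential v L x ≤ C)
    {e : Lp ℝ 2 (volume.restrict (cellN N L))} (he1 : ‖e‖ = 1)
    (hTe : pfkL2 v L 1 e = ‖pfkL2 (N := N) v L 1‖ • e)
    (hsimple : ∀ f, pfkL2 v L 1 f = ‖pfkL2 (N := N) v L 1‖ • f → ∃ c : ℝ, f = c • e)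
    {Ψ₀ : Config N → ℝ} (hΨe : Ψ₀ =ᵐ[volume.restrict (cellN N L)] (e : Config N → ℝ))
    (hΨ1 : ∀ X, Ψ₀ X = ‖pfkL2 (N := N) v L 1‖⁻¹ * pfkReal v L 1 (⇑e ∘ cellProj L) X)
    {g : Config N → ℝ} (hg : Measurable g)
    (hgper : ∀ (Y : Config N) (i : Fin N) (k : Fin 3),
      g (Y + Pi.single i (EuclideanSpace.single k L)) = g Y)
    (hg2 : ∫⁻ Y in cellN N L, ‖g Y‖ₑ ^ (2 : ℝ) ≠ ⊤) (X : Config N) :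
    Tendsto (fun T : ℝ => ‖pfkL2 (N := N) v L 1‖ ^ (-T) * pfkReal v L T g X) atTop
      (𝓝 ((∫ Y in cellN N L, Ψ₀ Y * g Y) * Ψ₀ X)) := by
  have hμ₀ : 0 < ‖pfkL2 (N := N) v L 1‖ :=
    norm_pos_iff.2 (pfkL2_perronFrobenius (N := N) hv hL hC one_pos).1
  -- the class of `g` in `L²(cell)` and its periodic representative
  have hgMem : MemLp g 2 (volume.restrict (cellN N L)) := by
    refine ⟨hg.aestronglyMeasurable, ?_⟩
    rw [eLpNorm_two_eq_cellN]
    exact ENNReal.rpow_lt_top_of_nonneg (by norm_num) hg2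
  obtain ⟨Gl, hGl'⟩ : ∃ Gl : Lp ℝ 2 (volume.restrict (cellN N L)), Gl = hgMem.toLp g := ⟨_, rfl⟩
  have hGl : (Gl : Config N → ℝ) =ᵐ[volume.restrict (cellN N L)] g := by
    rw [hGl']; exact hgMem.coeFn_toLp
  have hGlg : ∀ {t : ℝ}, 0 < t → pfkReal v L t (⇑Gl ∘ cellProj L) X = pfkReal v L t g X := by
    intro t ht
    rw [pfkReal_comp_cellProj_congr_ae v hL ht hGl X, comp_cellProj_eq_self hgper]
  have hinner : ⟪e, Gl⟫_ℝ = ∫ Y in cellN N L, Ψ₀ Y * g Y := by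
    rw [inner_Lp_eq_integral]
    refine integral_congr_ae ?_
    filter_upwards [hΨe, hGl] with Y h1 h2
    rw [h1, h2]
  have h0 := tendsto_rpow_mul_pfkReal_comp_cellProj hv hL hC he1 hTe hsimple Gl X
  -- shift the time by one and renormalise
  have h1 : Tendsto (fun t : ℝ => ‖pfkL2 (N := N) v L 1‖ ^ (-(1 + t)) * pfkReal v L (1 + t) g X)
      atTop (𝓝 ((∫ Y in cellN N L, Ψ₀ Y * g Y) * Ψ₀ X)) := by
    have h2 : (fun t : ℝ => ‖pfkL2 (N := N) v L 1‖⁻¹ *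
        (‖pfkL2 (N := N) v L 1‖ ^ (-t) * pfkReal v L (1 + t) (⇑Gl ∘ cellProj L) X)) =ᶠ[atTop]
        fun t : ℝ => ‖pfkL2 (N := N) v L 1‖ ^ (-(1 + t)) * pfkReal v L (1 + t) g X := by
      filter_upwards [eventually_gt_atTop 0] with t ht
      rw [hGlg (add_pos one_pos ht), neg_add, Real.rpow_add hμ₀, Real.rpow_neg_one, mul_assoc]
    have h3 := (h0.const_mul ‖pfkL2 (N := N) v L 1‖⁻¹).congr' h2
    convert h3 using 2
    rw [hinner, hΨ1 X]
    exact mul_left_comm _ _ _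
  have h4 := h1.comp (tendsto_atTop_add_const_right atTop (-1) tendsto_id)
  refine h4.congr fun T => ?_
  simp only [Function.comp_apply, id_eq]
  rw [show (1 : ℝ) + (T + -1) = T by ring]

/-- **`e^{λT} (e^{-TH_N^per} G)(X) → ⟨Ψ₀, G⟩_cell Ψ₀(X)` at every point `X`**, `λ = -log ‖e^{-H}‖`,
for periodic measurable `G : (ℝ³)^N → [0, ∞]` with `∫_cell G² < ∞` and a nonnegative `Ψ₀ ∈ L²(cell)`
as in `tendsto_rpow_mul_pfkReal`: that real-valued limit for `g = G.toReal` (`G = ofReal ∘ g` a.e.,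
being finite a.e. on the cell and periodic), rewritten in `[0, ∞]`. Glimm–Jaffe (1987) (3.4.2);
Chung–Zhao (1995) §8.3 (29)–(30). [cite: GlimmJaffeQP1987, §3.4 (3.4.2)] -/
theorem tendsto_exp_mul_periodicFKSemigroup {v : ℝ → ℝ≥0∞} (hv : Measurable v) {L : ℝ}
    (hL : 0 < L) {C : ℝ≥0} (hC : ∀ x, periodizedPotential v L x ≤ C)
    {e : Lp ℝ 2 (volume.restrict (cellN N L))} (he1 : ‖e‖ = 1)
    (hTe : pfkL2 v L 1 e = ‖pfkL2 (N := N) v L 1‖ • e)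
    (hsimple : ∀ f, pfkL2 v L 1 f = ‖pfkL2 (N := N) v L 1‖ • f → ∃ c : ℝ, f = c • e)
    {Ψ₀ : Config N → ℝ} (hΨe : Ψ₀ =ᵐ[volume.restrict (cellN N L)] (e : Config N → ℝ))
    (hΨnn : ∀ X, 0 ≤ Ψ₀ X) (hΨ2 : MemLp Ψ₀ 2 (volume.restrict (cellN N L)))
    (hΨ1 : ∀ X, Ψ₀ X = ‖pfkL2 (N := N) v L 1‖⁻¹ * pfkReal v L 1 (⇑e ∘ cellProj L) X)
    {lam : ℝ} (hlam : lam = -Real.log ‖pfkL2 (N := N) v L 1‖)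
    {G : Config N → ℝ≥0∞} (hG : Measurable G)
    (hGper : ∀ (Y : Config N) (i : Fin N) (k : Fin 3),
      G (Y + Pi.single i (EuclideanSpace.single k L)) = G Y)
    (hG2 : ∫⁻ Y in cellN N L, G Y ^ 2 ≠ ⊤) (X : Config N) :
    Tendsto (fun T : ℝ => ENNReal.ofReal (Real.exp (lam * T)) * periodicFKSemigroup v L T G X)
      atTop (𝓝 ((∫⁻ Y in cellN N L, ENNReal.ofReal (Ψ₀ Y) * G Y) * ENNReal.ofReal (Ψ₀ X))) := by
  have hμ₀ : 0 < ‖pfkL2 (N := N) v L 1‖ :=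
    norm_pos_iff.2 (pfkL2_perronFrobenius (N := N) hv hL hC one_pos).1
  have hexp : ∀ T : ℝ, Real.exp (lam * T) = ‖pfkL2 (N := N) v L 1‖ ^ (-T) := fun T => by
    rw [Real.rpow_def_of_pos hμ₀, hlam]; congr 1; ring
  -- the real observable `gr = G.toReal`: periodic, in `L²(cell)`, and `G = ofReal ∘ gr` a.e.
  have hG2' : ∫⁻ Y in cellN N L, G Y ^ (2 : ℝ) ≠ ⊤ := by simpa only [ENNReal.rpow_two] using hG2
  have hgrm : Measurable fun Y => (G Y).toReal := hG.ennreal_toReal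
  have hgr0 : ∀ Y, 0 ≤ (G Y).toReal := fun Y => ENNReal.toReal_nonneg
  have hgrper : ∀ (Y : Config N) (i : Fin N) (k : Fin 3),
      (G (Y + Pi.single i (EuclideanSpace.single k L))).toReal = (G Y).toReal := fun Y i k => by
    rw [hGper]
  have hGgr : G =ᵐ[(volume : Measure (Config N))] fun Y => ENNReal.ofReal (G Y).toReal := by
    refine ae_eq_of_periodic_of_ae_eq_cellN hL hGper (fun Y i k => by rw [hGper]) ?_
    have hfin : ∀ᵐ Y ∂volume.restrict (cellN N L), G Y < ⊤ := by
      filter_upwards [ae_lt_top (hG.pow_const 2) hG2] with Y hY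
      by_contra h
      rw [not_lt, top_le_iff] at h
      rw [h, ENNReal.top_pow two_ne_zero] at hY
      exact lt_irrefl _ hY
    filter_upwards [hfin] with Y hY
    exact (ENNReal.ofReal_toReal hY.ne).symm
  have hgr2 : ∫⁻ Y in cellN N L, ‖(G Y).toReal‖ₑ ^ (2 : ℝ) ≠ ⊤ := by
    refine ne_top_of_le_ne_top hG2' (lintegral_mono fun Y => ?_)
    gcongr
    rw [Real.enorm_of_nonneg (hgr0 Y)]
    exact ENNReal.ofReal_toReal_le
  have hgrMem : MemLp (fun Y => (G Y).toReal) 2 (volume.restrict (cellN N L)) := by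
    refine ⟨hgrm.aestronglyMeasurable, ?_⟩
    rw [eLpNorm_two_eq_cellN]
    exact ENNReal.rpow_lt_top_of_nonneg (by norm_num) hgr2
  -- real-valued convergence, then rewrite everything in `[0, ∞]`
  have hR' := ENNReal.tendsto_ofReal
    (tendsto_rpow_mul_pfkReal hv hL hC he1 hTe hsimple hΨe hΨ1 hgrm hgrper hgr2 X)
  have hprod : (∫⁻ Y in cellN N L, ENNReal.ofReal (Ψ₀ Y) * G Y) * ENNReal.ofReal (Ψ₀ X) =
      ENNReal.ofReal ((∫ Y in cellN N L, Ψ₀ Y * (G Y).toReal) * Ψ₀ X) := by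
    rw [ENNReal.ofReal_mul (integral_nonneg fun Y => mul_nonneg (hΨnn Y) (hgr0 Y))]
    congr 1
    have hint : Integrable (fun Y => Ψ₀ Y * (G Y).toReal) (volume.restrict (cellN N L)) :=
      hΨ2.integrable_mul hgrMem
    rw [ofReal_integral_eq_lintegral_ofReal hint
      (Eventually.of_forall fun Y => mul_nonneg (hΨnn Y) (hgr0 Y))]
    refine lintegral_congr_ae ?_
    filter_upwards [ae_restrict_of_ae (s := cellN N L) hGgr] with Y hY
    rw [ENNReal.ofReal_mul (hΨnn Y), ← hY]
  rw [hprod]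
  refine hR'.congr' ?_
  filter_upwards [eventually_gt_atTop 0] with T hT
  have hfin : periodicFKSemigroup v L T (fun Y => ENNReal.ofReal (G Y).toReal) X < ⊤ := by
    refine periodicFKSemigroup_lt_top_of_cell v hL hT hgrm.ennreal_ofReal
      (fun Y i k => by rw [hgrper]) ?_ X
    refine ne_top_of_le_ne_top hgr2 (lintegral_mono fun Y => ?_)
    rw [Real.enorm_of_nonneg (hgr0 Y)]
  rw [hexp, ENNReal.ofReal_mul (Real.rpow_nonneg hμ₀.le _), periodicFKSemigroup_congr_ae v L hT hGgr X,
    pfkReal_eq_toReal_periodicFKSemigroup hv L T hgrm hgr0 X, ENNReal.ofReal_toReal hfin.ne]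

/-! ### The theorem -/

/-- **Ground-state Feynman–Kac theorem on the torus for bounded periodised pair potentials** —
discharge of the named fact `PeriodicGroundStateFeynmanKac`: for `N ≥ 1`, `L > 0` and a measurable
pair potential `v` with bounded periodisation `v^per ≤ C`, the torus Hamiltonian `H_N^per` has a
cell-normalised, nonnegative, continuous, strictly positive, `Lℤ³`-periodic, permutation-symmetric
ground state `Ψ₀` in Feynman–Kac form (`IsPeriodicGroundStateFK`), with
`E₀ = periodicGroundStateEnergy v N L`. The witness is `Ψ₀ = ‖T_1‖⁻¹ T_1 |e ∘ cellProj L|` for the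
Perron–Frobenius eigenvector `e` of `T_1 = e^{-H_N^per}` on `L²([0,L)^{3N})`
(`pfkL2_perronFrobenius`); `E₀ = -log ‖T_1‖` by the variational identification
`periodicGroundStateEnergy_toReal_eq_of_feynmanKac`. Chung–Zhao (1995) §3.2 (26), Thm 3.10,
Props 3.11–3.15, Thm 3.27, Prop 3.29; Reed–Simon IV Thm XIII.44; Glimm–Jaffe Thms 3.3.2–3.3.3,
(3.4.2). [cite: ChungZhao1995, §3.2 (26), Thm 3.10 and Props 3.11–3.15; ReedSimonIV1978, Thm XIII.44] -/
theorem PeriodicGroundStateFeynmanKac_holds : PeriodicGroundStateFeynmanKac := by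
  intro N L v _hN hL hv hbdd
  obtain ⟨C, hC⟩ := hbdd
  -- Perron–Frobenius data at time one
  obtain ⟨hT0, e, he1, he0, hTe, -, hsimple⟩ := pfkL2_perronFrobenius (N := N) hv hL hC one_pos
  have hμ₀ : 0 < ‖pfkL2 (N := N) v L 1‖ := norm_pos_iff.2 hT0
  -- the witness
  obtain ⟨Ψ₀, hΨdef⟩ : ∃ Ψ₀ : Config N → ℝ, Ψ₀ = fun X => ‖pfkL2 (N := N) v L 1‖⁻¹ *
      pfkReal v L 1 (fun Y => |(e : Config N → ℝ) (cellProj L Y)|) X := ⟨_, rfl⟩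
  have hΨ : ∀ X, Ψ₀ X = ‖pfkL2 (N := N) v L 1‖⁻¹ *
      pfkReal v L 1 (fun Y => |(e : Config N → ℝ) (cellProj L Y)|) X := fun X => by rw [hΨdef]
  have hΨm : Measurable Ψ₀ := measurable_periodicWitness hv hΨ
  have hΨnn : ∀ X, 0 ≤ Ψ₀ X := periodicWitness_nonneg hΨ
  have hΨper := periodicWitness_periodic (N := N) hL.ne' hΨ
  have hΨcont : Continuous Ψ₀ := continuous_periodicWitness hv hL hC hΨ
  have hΨe : Ψ₀ =ᵐ[volume.restrict (cellN N L)] (e : Config N → ℝ) :=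
    periodicWitness_ae_eq_cellN hv hL hC he1 he0 hTe hsimple hΨ
  have hΨeig : ∀ T : ℝ, 0 < T → ∀ X, pfkReal v L T Ψ₀ X = ‖pfkL2 (N := N) v L 1‖ ^ T * Ψ₀ X :=
    fun T hT X => pfkReal_periodicWitness hv hL hC he1 he0 hTe hsimple hΨ hT X
  have hΨpos : ∀ X, 0 < Ψ₀ X := periodicWitness_pos hv hL hC he1 he0 hΨ
  have hΨsymm : ∀ (σ : Equiv.Perm (Fin N)) (X : Config N), Ψ₀ (X ∘ σ) = Ψ₀ X :=
    periodicWitness_symm hv hL hC he1 he0 hTe hsimple hΨ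
  have hΨ1 : ∀ X, Ψ₀ X = ‖pfkL2 (N := N) v L 1‖⁻¹ * pfkReal v L 1 (⇑e ∘ cellProj L) X := fun X => by
    rw [hΨ, pfkReal_congr_ae v L one_pos (abs_coeFn_cellProj_ae_eq hL he0) X]
  -- norms
  obtain ⟨M, -, hM⟩ := exists_bound_of_continuous_periodic hL hΨcont hΨper
  have hΨ2 : MemLp Ψ₀ 2 (volume.restrict (cellN N L)) := memLp_two_cellN_of_bound L hΨm hM
  have hnormL : ∫⁻ X in cellN N L, ENNReal.ofReal (Ψ₀ X) ^ 2 = 1 :=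
    setLIntegral_cellN_ofReal_sq_eq_one he1 hΨe hΨnn
  have hnormR : ∫ X in cellN N L, Ψ₀ X ^ 2 = 1 :=
    setIntegral_cellN_sq_eq_one hL hΨcont hΨper hΨnn hnormL
  -- the identification `E₀ = λ = -log ‖T_1‖`
  obtain ⟨lam, hlam⟩ : ∃ lam : ℝ, lam = -Real.log ‖pfkL2 (N := N) v L 1‖ := ⟨_, rfl⟩
  have hexp : ∀ t : ℝ, Real.exp (-(lam * t)) = ‖pfkL2 (N := N) v L 1‖ ^ t := fun t => by
    rw [Real.rpow_def_of_pos hμ₀, hlam]; congr 1; ring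
  have htop : ∀ f : Config N → ℝ, ContDiff ℝ 1 f →
      (∀ (X : Config N) (i : Fin N) (k : Fin 3),
        f (X + Pi.single i (EuclideanSpace.single k L)) = f X) →
      ∀ t : ℝ, 0 < t →
        ∫ X in cellN N L, f X * pfkReal v L t f X ≤
          Real.exp (-(lam * t)) * ∫ X in cellN N L, f X ^ 2 := by
    intro f hf hfper t ht
    obtain ⟨Mf, -, hMf⟩ := exists_bound_of_continuous_periodic hL hf.continuous hfper
    have hf2 : ∫⁻ Y in cellN N L, ‖f Y‖ₑ ^ (2 : ℝ) ≠ ⊤ := by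
      intro htop'
      have h := (memLp_two_cellN_of_bound L hf.continuous.measurable hMf).eLpNorm_lt_top
      rw [eLpNorm_two_eq_cellN, htop', ENNReal.top_rpow_of_pos (by norm_num)] at h
      exact lt_irrefl _ h
    rw [hexp]
    exact setIntegral_cellN_mul_pfkReal_le_rpow hv hL hC hf.continuous.measurable hfper hf2 ht
  have heig' : ∀ t : ℝ, 0 < t →
      Real.exp (-(lam * t)) ≤ ∫ X in cellN N L, Ψ₀ X * pfkReal v L t Ψ₀ X := by
    intro t ht
    have : (fun X => Ψ₀ X * pfkReal v L t Ψ₀ X) =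
        fun X => ‖pfkL2 (N := N) v L 1‖ ^ t * Ψ₀ X ^ 2 := by
      funext X; rw [hΨeig t ht X]; ring
    rw [hexp, this, integral_const_mul, hnormR, mul_one]
  obtain ⟨hEtop, hElam⟩ :=
    periodicGroundStateEnergy_toReal_eq_of_feynmanKac hL hv hC htop hΨcont hΨper hΨnn hΨsymm
      hnormR heig'
  -- assembly
  refine ⟨Ψ₀, ⟨hΨm, hΨnn, hΨper, hΨsymm, hnormL, hEtop, ?_, ?_⟩, hΨcont, hΨpos⟩
  · -- the eigen-relation, pointwise
    intro T hT X
    rw [hElam]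
    rcases hT.eq_or_lt with h | h
    · rw [← h, periodicFKSemigroup_of_nonpos v L le_rfl, mul_zero, neg_zero, Real.exp_zero, one_mul]
    · have hfin : periodicFKSemigroup v L T (fun Y => ENNReal.ofReal (Ψ₀ Y)) X < ⊤ := by
        refine periodicFKSemigroup_lt_top_of_cell v hL h hΨm.ennreal_ofReal
          (fun Y i k => by rw [hΨper]) ?_ X
        have h2 : ∫⁻ Y in cellN N L, ENNReal.ofReal (Ψ₀ Y) ^ (2 : ℝ) =
            ∫⁻ Y in cellN N L, ENNReal.ofReal (Ψ₀ Y) ^ 2 :=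
          lintegral_congr fun Y => ENNReal.rpow_two _
        rw [h2, hnormL]; exact ENNReal.one_ne_top
      rw [← ENNReal.ofReal_toReal hfin.ne, ← pfkReal_eq_toReal_periodicFKSemigroup hv L T hΨm hΨnn X,
        hΨeig T h X, hexp]
  · -- the ground-state projection
    intro G hG hGper hG2 X
    rw [hElam]
    exact tendsto_exp_mul_periodicFKSemigroup hv hL hC he1 hTe hsimple hΨe hΨnn hΨ2 hΨ1 hlam hG
      hGper hG2 X

end Literature.MathematicalPhysics.QuantumManyBody.BoseGas

end
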